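import Literature.NumberTheory.GaloisCohomology.Howard2004.DVRKolyvaginBound
import HarnessLib

/-!
# Currency of Howard's Theorem 1.6.1 conclusion: `𝒟 = Φ/R` is divisible, and
# `len_R(H/R·κ₁) = len_R(R/r₁R)` for `H ≅ R` free of rank one with `κ₁ ↦ r₁` (proofs file)

Topic `NumberTheory/GaloisCohomology/Howard2004` (next to `DVRKolyvaginBound`, p642393). THEOREMS ONLY: no
definition, no named fact, no instance, no `sorry`.

WHY (cell `pub/bsd-print-x9`, shared μ-item of routes PrintX9/PrintX10b, road R1′, SKELETON-v9-PLAN STUB 4 (ii)/(iv),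
seat `bsd-line-x9-p1` LEAD g3). `Howard2004.DVRSetting.Conclusion` (the typed conclusion of the cite-only fact
`thm161_dvrKolyvaginBound`, REF-131) delivers `H¹_𝓕(K, A) ≅ 𝒟 ⊕ M ⊕ M` with `𝒟 = FracModR R = Frac(R)/R` and the bound
`len_R M ≤ len_R (R ⧸ r₁R)` for `κ₁ = r₁ · x`, `x` the generator of the free rank-one `H¹_𝓕(K, T)`; the tree's
`SpecWitness` constructor `…HeegnerMuPartStabilized.nonempty_specWitness_of_howardShape` (p638335) wants instead
(a) `𝒟` DIVISIBLE by every non-zero-divisor (so that its Pontryagin dual is torsion-free, p637806) and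
(b) the bound in the form `len M ≤ len (H ⧸ R·κ₁)`. This file supplies exactly these two conversions, generically
(any domain `R`, any module `H ≅ R`).

* `FracModR.exists_smul_eq` — `∀ r ∈ R⁰, ∀ d : Frac(R)/R, ∃ d', r • d' = d`.
* `length_quotient_span_singleton_eq_of_linearEquiv` — for `e : H ≃ₗ[R] R` and `κ₁ : H`:
  `len_R (H ⧸ R ∙ κ₁) = len_R (R ⧸ span {e κ₁})`; and the `IsFreeRankOneOn`-flavoured variant
  `length_quotient_span_singleton_eq_of_smul_generator` for `κ₁ = r₁ • x` with `e x = 1`.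

References: [Howard2004HeegnerKolyvagin] B. Howard, Compositio Math. 140 (2004), Thm. 1.6.1 (arXiv:1202.6340
Thm. 2.6.1, p. 11 L17–28: «𝒟 = Φ/R … H¹_𝓕(K,T) is a free rank-one R-module … len_R(M) ≤ len_R(H¹_𝓕(K,T)/R·κ₁)»).
-/

noncomputable section

open scoped nonZeroDivisors

namespace Literature.NumberTheory.GaloisCohomology.Howard2004

/-! ## §1 `𝒟 = Frac(R)/R` is divisible -/

/-- **`𝒟 = Φ/R` is divisible**: every non-zero-divisor `r` of the domain `R` acts surjectively on
`Frac(R)/R` (`r • [a/(r b)] = [a/b]`). [cite: Howard2004HeegnerKolyvagin, §1.6 (arXiv p. 11, L18–19: 𝒟 = Φ/R)] -/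
theorem FracModR.exists_smul_eq (R : Type) [CommRing R] [IsDomain R] (r : R⁰) (d : FracModR R) :
    ∃ d' : FracModR R, (r : R) • d' = d := by
  obtain ⟨q, rfl⟩ := Submodule.Quotient.mk_surjective (p := (1 : Submodule R (FractionRing R))) d
  have hr : (algebraMap R (FractionRing R) r) ≠ 0 :=
    IsFractionRing.to_map_ne_zero_of_mem_nonZeroDivisors r.2
  refine ⟨Submodule.Quotient.mk ((algebraMap R (FractionRing R) r)⁻¹ * q), ?_⟩
  rw [← Submodule.Quotient.mk_smul, Algebra.smul_def, ← mul_assoc, mul_inv_cancel₀ hr, one_mul]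

/-! ## §2 `len_R(H/R·κ₁) = len_R(R/r₁R)` for `H ≅ R` -/

/-- **`len_R (H ⧸ R∙κ₁) = len_R (R ⧸ (e κ₁))`** for an `R`-linear `e : H ≃ R` (the two quotients are isomorphic:
`e` carries `R ∙ κ₁` onto the principal ideal of `e κ₁`). [cite: Howard2004HeegnerKolyvagin, Thm. 1.6.1 (arXiv p. 11, L25–28)] -/
theorem length_quotient_span_singleton_eq_of_linearEquiv {R : Type} [CommRing R] {H : Type} [AddCommGroup H]
    [Module R H] (e : H ≃ₗ[R] R) (κ₁ : H) :
    Module.length R (H ⧸ (R ∙ κ₁)) = Module.length R (R ⧸ Ideal.span {e κ₁}) := by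
  have hmap : (R ∙ κ₁).map (e : H →ₗ[R] R) = Ideal.span {e κ₁} := by
    rw [Submodule.map_span, Set.image_singleton]
    rfl
  exact (Submodule.Quotient.equiv (R ∙ κ₁) (Ideal.span {e κ₁}) e hmap).length_eq

/-- **`len_R (H ⧸ R∙κ₁) = len_R (R ⧸ r₁R)` when `κ₁ = r₁ • x` for a generator `x` (`e x = 1`)** — the form in
which `DVRSetting.Conclusion`'s bound `len M ≤ len (R ⧸ span {r₁})` becomes `len M ≤ len (H ⧸ R∙κ₁)`.
[cite: Howard2004HeegnerKolyvagin, Thm. 1.6.1 (arXiv p. 11, L25–28)] -/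
theorem length_quotient_span_singleton_eq_of_smul_generator {R : Type} [CommRing R] {H : Type}
    [AddCommGroup H] [Module R H] (e : H ≃ₗ[R] R) {x : H} (hx : e x = 1) (r₁ : R) {κ₁ : H}
    (hκ : κ₁ = r₁ • x) :
    Module.length R (H ⧸ (R ∙ κ₁)) = Module.length R (R ⧸ Ideal.span {r₁}) := by
  rw [length_quotient_span_singleton_eq_of_linearEquiv e κ₁, hκ, map_smul, hx, smul_eq_mul, mul_one]

end Literature.NumberTheory.GaloisCohomology.Howard2004

end
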